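import Summits.AtomisticToContinuum.HydrodynamicLimit.Theorems.RelayRaceLocalityNearConstantShortTimeHLDensityLDNetDefs
import HarnessLib

/-!
# Crux `NearConstantShortTimeHL` (stmt-AtomisticToContinuum-12502), line `small-tilt-domination` — the NET EXPANSION
# of the exponential of a capped quadratic sum (step 3 of the net reduction of `MesoscaleDensityLD`; lead c7, wave 1, W5)

Support file for the crux `…Theses.RelayRaceLocality.NearConstantShortTimeHL`, line `small-tilt-domination`,
registered stub `exp_sum_min_one_sq_le_net_sum`.

For nonnegative weights `a j`, deviations `d j` (`j` in a finite index type `J`), `c ≥ 0` and a net resolution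
`m ≥ 1`, the exponential of the capped quadratic sum `c Σ_j a_j min 1 d_j²` is dominated, up to the factor
`exp(c Σ_j a_j / (4m²))`, by the SUM over all net selections `s : J → Fin (4m+1)` of the exponentials of the
LINEAR-in-`d` sums `c Σ_j a_j (λ_{s j} d_j − λ_{s j}²/4)`, `λ_i = i/m − 2`.

Proof: by the net lemma `min_one_sq_le_net` (`…DensityLDNetDefs`) choose for each `j` a net index `s₀ j`
with `min 1 d_j² ≤ λ_{s₀ j} d_j − λ_{s₀ j}²/4 + 1/(4m²)`; multiply by `a_j ≥ 0`, sum over `j`, multiply by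
`c ≥ 0` and exponentiate: the left side is at most `exp(c Σ a /(4m²)) · exp(c Σ_j a_j (λ_{s₀ j} d_j − λ_{s₀ j}²/4))`,
and the second factor is one of the (nonnegative) summands of the sum over all selections.

References: folklore (finite sums and monotonicity of `exp`).
-/

noncomputable section

namespace Summit.AtomisticToContinuum.HydrodynamicLimit.Theorems.NearConstantShortTimeHL

open scoped BigOperators ENNReal
open MeasureTheory Set Filter Topology
open Literature.MathematicalPhysics.KineticTheory Literature.Analysis.FluidPDE Literature.Analysis.FunctionSpaces

/-- **Net expansion of the exponential of a capped quadratic sum.** For `m ≥ 1`, nonnegative weights `a`,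
deviations `d` and `c ≥ 0`,
`exp(c Σ_j a_j min 1 d_j²) ≤ exp(c (Σ_j a_j)/(4m²)) · Σ_{s : J → Fin (4m+1)} exp(c Σ_j a_j (λ_{s j} d_j − λ_{s j}²/4))`
with `λ_i = i/m − 2`: pick for each `j` the net point of `min_one_sq_le_net`, sum, exponentiate, and bound the
resulting single exponential by the sum over all selections. [folklore] -/
theorem exp_sum_min_one_sq_le_net_sum : ∀ {m : ℕ}, 0 < m → ∀ {J : Type} [Fintype J] [DecidableEq J] (a d : J → ℝ), (∀ j, 0 ≤ a j) → ∀ {c : ℝ}, 0 ≤ c → Real.exp (c * ∑ j, a j * min 1 (d j ^ 2)) ≤ Real.exp (c * (∑ j, a j) / (4 * (m : ℝ) ^ 2)) * ∑ s : J → Fin (4 * m + 1), Real.exp (c * ∑ j, a j * ((((s j : ℕ) : ℝ) / m - 2) * d j - (((s j : ℕ) : ℝ) / m - 2) ^ 2 / 4)) := by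
  intro m hm J _ _ a d ha c hc
  -- the net selection `s₀ : J → Fin (4m+1)` of `min_one_sq_le_net`, one index per `j`
  choose s₀ hs₀ using fun j => min_one_sq_le_net hm (d j)
  -- weighted sum of the pointwise net bounds
  have hsum : ∑ j, a j * min 1 (d j ^ 2) ≤
      ∑ j, a j * ((((s₀ j : ℕ) : ℝ) / m - 2) * d j - (((s₀ j : ℕ) : ℝ) / m - 2) ^ 2 / 4) +
        (∑ j, a j) / (4 * (m : ℝ) ^ 2) := by
    rw [Finset.sum_div, ← Finset.sum_add_distrib]
    refine Finset.sum_le_sum fun j _ => ?_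
    calc a j * min 1 (d j ^ 2)
        ≤ a j * ((((s₀ j : ℕ) : ℝ) / m - 2) * d j - (((s₀ j : ℕ) : ℝ) / m - 2) ^ 2 / 4 +
            1 / (4 * (m : ℝ) ^ 2)) := mul_le_mul_of_nonneg_left (hs₀ j) (ha j)
      _ = a j * ((((s₀ j : ℕ) : ℝ) / m - 2) * d j - (((s₀ j : ℕ) : ℝ) / m - 2) ^ 2 / 4) +
            a j / (4 * (m : ℝ) ^ 2) := by ring
  -- multiply by `c ≥ 0`
  have hexp : c * ∑ j, a j * min 1 (d j ^ 2) ≤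
      c * (∑ j, a j) / (4 * (m : ℝ) ^ 2) +
        c * ∑ j, a j * ((((s₀ j : ℕ) : ℝ) / m - 2) * d j - (((s₀ j : ℕ) : ℝ) / m - 2) ^ 2 / 4) := by
    calc c * ∑ j, a j * min 1 (d j ^ 2)
        ≤ c * (∑ j, a j * ((((s₀ j : ℕ) : ℝ) / m - 2) * d j - (((s₀ j : ℕ) : ℝ) / m - 2) ^ 2 / 4) +
            (∑ j, a j) / (4 * (m : ℝ) ^ 2)) := mul_le_mul_of_nonneg_left hsum hc
      _ = c * (∑ j, a j) / (4 * (m : ℝ) ^ 2) +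
            c * ∑ j, a j * ((((s₀ j : ℕ) : ℝ) / m - 2) * d j - (((s₀ j : ℕ) : ℝ) / m - 2) ^ 2 / 4) := by
          ring
  -- exponentiate and bound the single selected exponential by the sum over all selections
  calc Real.exp (c * ∑ j, a j * min 1 (d j ^ 2))
      ≤ Real.exp (c * (∑ j, a j) / (4 * (m : ℝ) ^ 2) +
          c * ∑ j, a j * ((((s₀ j : ℕ) : ℝ) / m - 2) * d j - (((s₀ j : ℕ) : ℝ) / m - 2) ^ 2 / 4)) :=
        Real.exp_le_exp.2 hexp
    _ = Real.exp (c * (∑ j, a j) / (4 * (m : ℝ) ^ 2)) *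
          Real.exp (c * ∑ j, a j * ((((s₀ j : ℕ) : ℝ) / m - 2) * d j - (((s₀ j : ℕ) : ℝ) / m - 2) ^ 2 / 4)) :=
        Real.exp_add _ _
    _ ≤ Real.exp (c * (∑ j, a j) / (4 * (m : ℝ) ^ 2)) *
          ∑ s : J → Fin (4 * m + 1),
            Real.exp (c * ∑ j, a j * ((((s j : ℕ) : ℝ) / m - 2) * d j - (((s j : ℕ) : ℝ) / m - 2) ^ 2 / 4)) := by
        refine mul_le_mul_of_nonneg_left ?_ (Real.exp_pos _).le
        exact Finset.single_le_sum
          (f := fun s : J → Fin (4 * m + 1) =>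
            Real.exp (c * ∑ j, a j * ((((s j : ℕ) : ℝ) / m - 2) * d j - (((s j : ℕ) : ℝ) / m - 2) ^ 2 / 4)))
          (fun s _ => (Real.exp_pos _).le) (Finset.mem_univ s₀)

end Summit.AtomisticToContinuum.HydrodynamicLimit.Theorems.NearConstantShortTimeHL

end
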